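import Summits.NavierStokesRegularity.NavierStokesRegularity.Theorems.CriticalCoherenceDoorDefs
import HarnessLib

/-!
# CriticalCoherenceDoorPower — door S33 «CriticalCoherenceDoor», plate A33 `EnstrophyPowerBoundAssembly`
# PROVED: the two-threshold stretching estimate (T33) and the power-weighted slab Grönwall inequality (G33)
# give the sub-Leray power bound `∫|∇u(t)|²_F ≤ K (T − t)^{−a}`, `a < 1/2` (P1 `EnstrophyPowerBound`)

S-door lane (LEAD ns-s30-p1 g2, plate map 13:14:22Z; planner of record nsreg-p1 g27, ROUND-31 / PLATE-AID-33
ac753e4a397d9491), seat nsreg-C26-p1 g5, `--supports stmt-NavierStokesRegularity-0056 --as helper`.  BY NAME against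
the texts of record `Theorems/CriticalCoherenceDoorDefs.lean` (plate P0): the hypotheses are the Prop NAMES
`TwoThresholdStretching` (T33) and `PowerGronwallSlab` (G33); nothing is restated.

Proof (the glue of PLATE-AID-33 §A33; no new idea): the exponent algebra `η := (√3/(4ε₀) − 1)/2 > 0`,
`a := (2/√3)(1+η)ε₀ = ε₀/√3 + 1/4 ∈ [0, 1/2)` (`exponent_of_lt_sqrt_three_div_four`); at `t₀ = 0`
(`enstrophyPowerBound_zero`): Tao's energy class `Ē, I` on every closed slab `[0, T'']`
(`tao_finite_energy_smooth_energy_bound_holds`, verbatim the bookkeeping of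
`Literature.Analysis.FluidPDE.exists_uniform_H1_bound_of_holderHalf_direction`), T33 at each time `s` of the slab with
the MOVING threshold `Ωₓ := ε₀/(T − s)` (so `ε₀ < (T − s)|ω(x,s)| ↔ Ωₓ < |ω(x,s)|` and the low coefficient is
`a/(T − s)`), G33 on the slab, `K := (∫|ω(0)|² + C₄ I)·T^a·exp((C₁ + C₃Ē)T + C₂‖curl‖²I)` uniform in `T''`,
`(T/(T − t))^a = T^a (T − t)^{−a}`, and `∫|∇u|²_F ≤ ∫|ω|²`
(`lintegral_frobeniusNormSq_fderiv_le_lintegral_sq_norm_curl`); general `t₀` by time translation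
(`IsClassicalNSSolutionOn.translate_Ico_zero`; `CriticalCoherence` translates because `T − t = (T − t₀) − (t − t₀)`).
WHAT THIS IS NOT: T33 and G33 are NOT proved here (they are the hypotheses, by name); S33 is a regularity CRITERION on
hypothetical blow-up; item 0056 `NoTypeII` and NS regularity are NOT proved.
-/

noncomputable section

open MeasureTheory Set Function Filter Metric Real InnerProductSpace
open _root_.Topology
open scoped ENNReal NNReal RealInnerProductSpace ContDiff
open Literature.Analysis.FluidPDE

set_option linter.dupNamespace false

namespace Summit.NavierStokesRegularity.NavierStokesRegularity.Theorems.CriticalCoherenceDoor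

-- nested operator types (second derivatives)
set_option maxSynthPendingDepth 3

/-- The exponent algebra of A33: for `0 < ε₀ < √3/4`, `η := (√3/(4ε₀) − 1)/2` is positive and
`a := (2/√3)(1+η)ε₀` (which equals `ε₀/√3 + 1/4`) satisfies `0 ≤ a < 1/2`. [folklore] -/
theorem exponent_of_lt_sqrt_three_div_four {ε₀ : ℝ} (hε₀ : 0 < ε₀) (hε₁ : ε₀ < Real.sqrt 3 / 4) :
    0 < (Real.sqrt 3 / (4 * ε₀) - 1) / 2 ∧
    0 ≤ 2 / Real.sqrt 3 * (1 + (Real.sqrt 3 / (4 * ε₀) - 1) / 2) * ε₀ ∧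
    2 / Real.sqrt 3 * (1 + (Real.sqrt 3 / (4 * ε₀) - 1) / 2) * ε₀ < 1 / 2 := by
  have h3 : 0 < Real.sqrt 3 := Real.sqrt_pos.2 (by norm_num)
  have hq : 1 < Real.sqrt 3 / (4 * ε₀) := by
    rw [lt_div_iff₀ (by positivity)]
    linarith
  refine ⟨by linarith, by positivity, ?_⟩
  have hid : 2 / Real.sqrt 3 * (1 + (Real.sqrt 3 / (4 * ε₀) - 1) / 2) * ε₀ =
      ε₀ / Real.sqrt 3 + 1 / 4 := by
    field_simp
    ring
  rw [hid]
  have : ε₀ / Real.sqrt 3 < 1 / 4 := by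
    rw [div_lt_iff₀ h3]
    linarith
  linarith

/-- **A33 at `t₀ = 0`.** Let `ν > 0`, `T > 0`, `0 < ε₀ < √3/4`, `Ω > 0`, `M` real, `(u, p)` a classical
unforced Navier–Stokes solution on `ℝ³ × [0, T)` with all `L²` Sobolev seminorms bounded on every `[0, T'']`,
`T'' < T`, satisfying `CriticalCoherence u T 0 ε₀ Ω M`. If `TwoThresholdStretching` and `PowerGronwallSlab`
hold, then `∫|∇u(t)|²_F ≤ K (T − t)^{−a}` on `[0, T)` for some `K ≥ 0` and `a < 1/2` (namely
`a = ε₀/√3 + 1/4`). Proof: see the module docstring. [folklore] -/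
theorem enstrophyPowerBound_zero (hT : TwoThresholdStretching) (hG : PowerGronwallSlab)
    {ν T ε₀ Ω M : ℝ} (hν : 0 < ν) (hTpos : 0 < T) (hε₀ : 0 < ε₀) (hε₁ : ε₀ < Real.sqrt 3 / 4)
    (hΩ : 0 < Ω) {u : ℝ → (EuclideanSpace ℝ (Fin 3)) → (EuclideanSpace ℝ (Fin 3))}
    {p : ℝ → (EuclideanSpace ℝ (Fin 3)) → ℝ}
    (hsol : IsClassicalNSSolutionOn (Ico 0 T) ν 0 u p)
    (hreg : ∀ T'' < T, HasBoundedSobolevNormsOn (Icc 0 T'') u)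
    (hcoh : CriticalCoherence u T 0 ε₀ Ω M) :
    ∃ K a : ℝ, 0 ≤ K ∧ a < 1 / 2 ∧ ∀ t ∈ Ico 0 T,
      (∫⁻ x, ENNReal.ofReal (frobeniusNormSq (fderiv ℝ (u t) x))) ≤
        ENNReal.ofReal (K * (T - t) ^ (-a)) := by
  obtain ⟨hη, ha0, ha⟩ := exponent_of_lt_sqrt_three_div_four hε₀ hε₁
  set η : ℝ := (Real.sqrt 3 / (4 * ε₀) - 1) / 2 with hηdef
  set a : ℝ := 2 / Real.sqrt 3 * (1 + η) * ε₀ with hadef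
  obtain ⟨C, hCtop, hTao⟩ := tao_finite_energy_smooth_energy_bound_holds
  obtain ⟨C₁, C₂, C₃, C₄, hC₁, hC₂, hC₃, hC₄, hstr⟩ := hT ν Ω M η hν hΩ hη
  -- the initial energy and enstrophy
  have hreg0 : HasBoundedSobolevNormsOn (Icc 0 (T / 2)) u := hreg (T / 2) (by linarith)
  have h00 : (0 : ℝ) ∈ Icc 0 (T / 2) := ⟨le_rfl, by linarith⟩
  set E₀ : ℝ≥0∞ := ∫⁻ x, ‖u 0 x‖ₑ ^ 2 with hE₀
  have hE₀top : E₀ < ⊤ := by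
    obtain ⟨C0, hC0⟩ := hreg0 0
    refine lt_of_le_of_lt (le_of_eq (lintegral_congr fun x => ?_))
      ((hC0 0 h00).trans_lt ENNReal.coe_lt_top)
    rw [← ofReal_norm, ← ofReal_norm, norm_iteratedFDeriv_zero]
  have hCE : C * E₀ < ⊤ := ENNReal.mul_lt_top hCtop hE₀top
  set Ē : ℝ := (C * E₀).toReal with hĒ
  have hĒ0 : 0 ≤ Ē := ENNReal.toReal_nonneg
  set I : ℝ := (C * E₀ / ENNReal.ofReal ν).toReal with hIdef
  have hI0 : 0 ≤ I := ENNReal.toReal_nonneg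
  set Y₀ : ℝ := ∫ x, ‖curl (u 0) x‖ ^ 2 with hY₀
  have hY₀0 : 0 ≤ Y₀ := integral_nonneg fun x => sq_nonneg _
  have hTa : 0 ≤ T ^ a := Real.rpow_nonneg hTpos.le _
  set X : ℝ := Real.exp ((C₁ + C₃ * Ē) * T + C₂ * (‖curlCLM‖ ^ 2 * I)) with hXdef
  have hX0 : 0 ≤ X := (Real.exp_pos _).le
  refine ⟨(Y₀ + C₄ * I) * T ^ a * X, a,
    mul_nonneg (mul_nonneg (add_nonneg hY₀0 (mul_nonneg hC₄ hI0)) hTa) hX0, ha, ?_⟩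
  intro t ht
  have hTt : 0 < T - t := by linarith [ht.2]
  -- a closed slab containing `t`
  set T'' : ℝ := (t + T) / 2 with hT''def
  have htT'' : t < T'' := by rw [hT''def]; linarith [ht.2]
  have hT''T : T'' < T := by rw [hT''def]; linarith [ht.2]
  have hT''pos : 0 < T'' := lt_of_le_of_lt ht.1 htT''
  have hS : IsClassicalNSSolutionOn (Icc 0 T'') ν 0 u p :=
    hsol.mono (Icc_subset_Ico_right hT''T) (uniqueDiffOn_Icc hT''pos)
  have hB : HasBoundedSobolevNormsOn (Icc 0 T'') u := hreg T'' hT''T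
  have htS : t ∈ Icc 0 T'' := ⟨ht.1, htT''.le⟩
  -- Tao's energy class on the slab
  have hfe : ∃ A : ℝ≥0∞, A < ⊤ ∧ ∀ s ∈ Icc 0 T'', ∫⁻ x, ‖u s x‖ₑ ^ 2 ≤ A := by
    obtain ⟨C0, hC0⟩ := hB 0
    refine ⟨C0, ENNReal.coe_lt_top, fun s hs => ?_⟩
    refine le_trans (le_of_eq (lintegral_congr fun x => ?_)) (hC0 s hs)
    rw [← ofReal_norm, ← ofReal_norm, norm_iteratedFDeriv_zero]
  obtain ⟨hen, hdiss⟩ := hTao ν T'' hν hT''pos u p hS hfe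
  have hen' : ∀ s ∈ Icc 0 T'', ∫⁻ x, ‖u s x‖ₑ ^ 2 ≤ ENNReal.ofReal Ē := fun s hs => by
    rw [hĒ, ENNReal.ofReal_toReal hCE.ne]
    exact hen s hs
  have hdiss' : ∫⁻ s in Ioo 0 T'', ∫⁻ x, ENNReal.ofReal (frobeniusNormSq (fderiv ℝ (u s) x)) ≤
      ENNReal.ofReal I := by
    have hν' : ENNReal.ofReal ν ≠ 0 := (ENNReal.ofReal_pos.2 hν).ne'
    have h1 : ∫⁻ s in Ioo 0 T'', ∫⁻ x, ENNReal.ofReal (frobeniusNormSq (fderiv ℝ (u s) x)) ≤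
        C * E₀ / ENNReal.ofReal ν := by
      rw [ENNReal.le_div_iff_mul_le (Or.inl hν') (Or.inl ENNReal.ofReal_ne_top), mul_comm]
      exact hdiss
    refine h1.trans (le_of_eq ?_)
    rw [hIdef, ENNReal.ofReal_toReal]
    exact (ENNReal.div_lt_top hCE.ne hν').ne
  -- the two-threshold stretching estimate on the slab, at the moving threshold `Ωₓ = ε₀/(T − s)`
  have hstrS : ∀ s ∈ Icc 0 T'',
      2 * ∫ x, ⟪curl (u s) x, fderiv ℝ (u s) x (curl (u s) x)⟫ ≤
        ν * (∫ x, frobeniusNormSq (fderiv ℝ (curl (u s)) x)) +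
          (a / (T - s) + C₁ + C₂ * (∫ x, ‖curl (u s) x‖ ^ 2) + C₃ * (∫ x, ‖u s x‖ ^ 2)) *
            (∫ x, ‖curl (u s) x‖ ^ 2) +
          C₄ * (∫ x, frobeniusNormSq (fderiv ℝ (u s) x)) := by
    intro s hs
    have hsT : s ∈ Ico 0 T := ⟨hs.1, hs.2.trans_lt hT''T⟩
    have hTs : 0 < T - s := by linarith [hsT.2]
    have hΩx : 0 < ε₀ / (T - s) := div_pos hε₀ hTs
    have hv : ContDiff ℝ ∞ (u s) := hS.contDiff_velocity hs
    have hv4 : ContDiff ℝ 4 (u s) := hv.of_le (by norm_cast)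
    have hv2 : ContDiff ℝ 2 (u s) := hv.of_le (by norm_cast)
    have hfin : ∀ n, ∫⁻ x, ‖iteratedFDeriv ℝ n (u s) x‖ₑ ^ 2 < ⊤ := fun n => by
      obtain ⟨Cn, hCn⟩ := hB n
      exact (hCn s hs).trans_lt ENNReal.coe_lt_top
    have i0 : Integrable fun x => ‖u s x‖ ^ 2 :=
      integrable_sq_norm_of_lintegral_lt_top hv.continuous
        ((hen' s hs).trans_lt ENNReal.ofReal_lt_top)
    have i1 : Integrable fun x => ‖fderiv ℝ (u s) x‖ ^ 2 := by
      have h := integrable_sq_norm_of_lintegral_lt_top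
        (hv4.continuous_iteratedFDeriv (by norm_num)) (hfin 1)
      exact h.congr (Eventually.of_forall fun x => by simp only [norm_iteratedFDeriv_one])
    have i2 : Integrable fun x => ‖fderiv ℝ (fderiv ℝ (u s)) x‖ ^ 2 := by
      have h := integrable_sq_norm_of_lintegral_lt_top
        (hv4.continuous_iteratedFDeriv (by norm_num)) (hfin 2)
      refine h.congr (Eventually.of_forall fun x => ?_)
      show ‖iteratedFDeriv ℝ 2 (u s) x‖ ^ 2 = ‖fderiv ℝ (fderiv ℝ (u s)) x‖ ^ 2
      rw [← norm_iteratedFDeriv_fderiv, norm_iteratedFDeriv_one]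
    obtain ⟨B₂, -, hB₂⟩ := exists_forall_norm_fderiv_fderiv_le_of_hasBoundedSobolevNormsOn
      (fun r hr => (hS.contDiff_velocity hr).of_le (by norm_cast)) hB
    have hpair : ∀ x y : EuclideanSpace ℝ (Fin 3), ε₀ / (T - s) < ‖curl (u s) x‖ →
        Ω < ‖curl (u s) y‖ →
        Real.sqrt (1 - ⟪vorticityDirection (curl (u s)) x,
          vorticityDirection (curl (u s)) y⟫ ^ 2) ≤ M * Real.sqrt ‖x - y‖ := by
      intro x y hx hy
      refine hcoh s hsT x y ?_ hy
      rw [div_lt_iff₀ hTs] at hx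
      rw [mul_comm]
      exact hx
    have h := hstr (ε₀ / (T - s)) hΩx hv2 (hS.divFree s hs) i0 i1 i2 ⟨B₂, hB₂ s hs⟩ hpair
    have hcoef : 2 / Real.sqrt 3 * (1 + η) * (ε₀ / (T - s)) = a / (T - s) := by
      rw [hadef]
      ring
    rw [hcoef] at h
    exact h
  -- the power-weighted slab Grönwall inequality
  have hY := hG ν T T'' a hν hT''pos hT''T ha0 u p hS hB Ē I hĒ0 hI0 hen' hdiss'
    C₁ C₂ C₃ C₄ hC₁ hC₂ hC₃ hC₄ hstrS t htS
  have hKt : ∫ x, ‖curl (u t) x‖ ^ 2 ≤ (Y₀ + C₄ * I) * T ^ a * X * (T - t) ^ (-a) := by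
    refine hY.trans ?_
    have hdiv : (T / (T - t)) ^ a = T ^ a * (T - t) ^ (-a) := by
      rw [Real.div_rpow hTpos.le hTt.le, Real.rpow_neg hTt.le, div_eq_mul_inv]
    rw [hdiv]
    have hexp : Real.exp ((C₁ + C₃ * Ē) * T'' + C₂ * (‖curlCLM‖ ^ 2 * I)) ≤ X := by
      rw [hXdef]
      refine Real.exp_le_exp.2 ?_
      have : (C₁ + C₃ * Ē) * T'' ≤ (C₁ + C₃ * Ē) * T :=
        mul_le_mul_of_nonneg_left hT''T.le (by positivity)
      linarith
    have hpos1 : 0 ≤ (Y₀ + C₄ * I) * (T ^ a * (T - t) ^ (-a)) :=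
      mul_nonneg (add_nonneg hY₀0 (mul_nonneg hC₄ hI0))
        (mul_nonneg hTa (Real.rpow_nonneg hTt.le _))
    calc (Y₀ + C₄ * I) * (T ^ a * (T - t) ^ (-a)) *
          Real.exp ((C₁ + C₃ * Ē) * T'' + C₂ * (‖curlCLM‖ ^ 2 * I))
        ≤ (Y₀ + C₄ * I) * (T ^ a * (T - t) ^ (-a)) * X :=
          mul_le_mul_of_nonneg_left hexp hpos1
      _ = (Y₀ + C₄ * I) * T ^ a * X * (T - t) ^ (-a) := by ring
  -- `∫|∇u|²_F ≤ ∫|ω|²`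
  have hvt : ContDiff ℝ ∞ (u t) := hS.contDiff_velocity htS
  have hcurl_int : Integrable fun x => ‖curl (u t) x‖ ^ 2 := by
    have hfin1 : ∫⁻ x, ‖iteratedFDeriv ℝ 1 (u t) x‖ₑ ^ 2 < ⊤ := by
      obtain ⟨C1, hC1⟩ := hB 1
      exact (hC1 t htS).trans_lt ENNReal.coe_lt_top
    refine integrable_sq_norm_of_lintegral_lt_top (continuous_curl (hvt.of_le (by norm_cast))) ?_
    exact lt_of_le_of_lt (lintegral_curl_sq_le (u t))
      (ENNReal.mul_lt_top ENNReal.ofReal_lt_top hfin1)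
  refine (lintegral_frobeniusNormSq_fderiv_le_lintegral_sq_norm_curl
    (hvt.of_le (by norm_cast)) (hS.divFree t htS)
    ((hen' t htS).trans_lt ENNReal.ofReal_lt_top)).trans ?_
  rw [show (∫⁻ x, ‖curl (u t) x‖ₑ ^ 2) = ∫⁻ x, ENNReal.ofReal (‖curl (u t) x‖ ^ 2) from
    lintegral_congr fun x => by rw [← ofReal_norm, ENNReal.ofReal_pow (norm_nonneg _)],
    ← ofReal_integral_eq_lintegral_ofReal hcurl_int (Eventually.of_forall fun x => sq_nonneg _)]
  exact ENNReal.ofReal_le_ofReal hKt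

/-- **Plate A33 «EnstrophyPowerBoundAssembly» PROVED**: `TwoThresholdStretching → PowerGronwallSlab →
EnstrophyPowerBound` (the Prop names of `Theorems/CriticalCoherenceDoorDefs.lean`). Proof: translate time by
`t₀` (`IsClassicalNSSolutionOn.translate_Ico_zero`; the Sobolev bounds and `CriticalCoherence` translate, the latter
because `T − t = (T − t₀) − (t − t₀)`), apply `enstrophyPowerBound_zero` on `[0, T − t₀)`, translate back.
[folklore] -/
theorem enstrophyPowerBoundAssembly_holds : EnstrophyPowerBoundAssembly := by
  intro hT hG ν T t₀ ε₀ Ω M hν ht₀ ht₀T hε₀ hε₁ hΩ u p hsol hreg hcoh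
  have hTt : 0 < T - t₀ := by linarith
  -- the translate
  have hsol' : IsClassicalNSSolutionOn (Ico 0 (T - t₀)) ν 0 (fun t => u (t + t₀))
      (fun t => p (t + t₀)) := hsol.translate_Ico_zero ht₀
  have hreg' : ∀ T'' < T - t₀, HasBoundedSobolevNormsOn (Icc 0 T'') (fun t => u (t + t₀)) := by
    intro T'' hT'' n
    obtain ⟨C, hC⟩ := hreg (T'' + t₀) (by linarith) n
    exact ⟨C, fun t ht => hC (t + t₀) ⟨by linarith [ht.1], by linarith [ht.2]⟩⟩
  have hcoh' : CriticalCoherence (fun t => u (t + t₀)) (T - t₀) 0 ε₀ Ω M := by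
    intro t ht x y hx hy
    refine hcoh (t + t₀) ⟨by linarith [ht.1], by linarith [ht.2]⟩ x y ?_ hy
    have hTT : T - (t + t₀) = T - t₀ - t := by ring
    rw [hTT]
    exact hx
  obtain ⟨K, a, hK0, ha, hF⟩ :=
    enstrophyPowerBound_zero hT hG hν hTt hε₀ hε₁ hΩ hsol' hreg' hcoh'
  refine ⟨K, a, hK0, ha, fun t ht => ?_⟩
  have h := hF (t - t₀) ⟨by linarith [ht.1], by linarith [ht.2]⟩
  have hTT : T - t₀ - (t - t₀) = T - t := by ring
  simp only [sub_add_cancel, hTT] at h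
  exact h

end Summit.NavierStokesRegularity.NavierStokesRegularity.Theorems.CriticalCoherenceDoor

end
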